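import Mathlib
import Summits.NavierStokesRegularity.NavierStokesRegularity.Theorems.SubOnsagerCeilingVirtualFloorGame
import HarnessLib

/-!
# The virtual-floor game reduction, TOP-SHELL form (the bootstrap asymmetry)
(helper file for crux stmt-NavierStokesRegularity-27057 `SubOnsagerCeiling.ForwardTailCeilingKP`, `--supports … --as helper`;
LEAD SOC census v11 / line «kp-shell-barrier», virtual-floor game)

`VirtualFloor.gameBarrier_le_one_of_tail_geom` (p664618) reduces the chain barrier to a GAME HYPOTHESIS that asks a certificate
to keep EVERY real shell of the depth-`k` window `< 1` along every play from data `≤ δ₀`. In the first-crossing argument this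
is wasteful: at the would-be crossing time `T` of shell `N`, ALL shells are `≤ 1` on `[0, T]` by the bootstrap itself, so the
window placed with `N` at its TOP already knows that its lower shells (and its top shell, up to time `T`) are `≤ 1`; the only
thing the certificate must deliver is `S_k(T) < 1` for the TOP shell. This file proves that sharper reduction:

* the game hypothesis `hGame` receives the extra hypothesis «every real shell of the play is `≤ 1` on `[0, T]`» and has the
  weaker conclusion «the TOP shell is `< 1` on `[0, T]`»;
* the chain is given with `k + 1` identically vanishing shells at the bottom (`Y 0 = … = Y k = 0`; on the lattice these are the
  shells below the datum), so that EVERY live shell `n ≥ k + 1` is the top of a full window `n - k, …, n` and no short-window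
  case arises.

Measured effect (LEAD g8 numerics, census v11): at `b = 3/2` the depth-2 game value drops from `0.931` (all shells; binding at
the BOTTOM shell) to `0.875` (top shell only); at `b = 5/4`, depth 3: `0.994 → 0.946`, depth 4: `0.96–0.98 → 0.90`. The
certificate's slack requirement is roughly halved at every ratio.

HONEST FRAMING: an abstract ODE lemma towards a MODEL-lattice rung (crux `ForwardTailCeilingKP`, route SubOnsagerCeiling,
TL-M2Break); by itself it proves no class of tables; nothing here bears on Navier–Stokes regularity; 27057 stays OPEN.
[cite: BarbatoMorandinRomito2011, §2 Lemma 2.1 (the first-exit / bootstrap scheme this sharpens)]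
-/

noncomputable section

-- the sub-problem namespace `NavierStokesRegularity.NavierStokesRegularity` is the tree's layout (D-0017)
set_option linter.dupNamespace false

namespace Summit.NavierStokesRegularity.NavierStokesRegularity.Theorems.VirtualFloor

open Set Filter Topology

/-- **THE VIRTUAL-FLOOR GAME REDUCTION, TOP-SHELL FORM.** Rescaled chain `Ẏₙ = -κₙYₙ + Fₙ(Y²ₙ₋₁ - pYₙYₙ₊₁)` with rigid
rates `Fₙ₊₁ = L·Fₙ`, rigid dampings `κₙ₊₁ = b2·κₙ ≥ 0`, non-negative shells, data `≤ δ₀ < 1`, a quiescent tail `Yₙ ≤ δ₀`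
for `n ≥ K`, and `k + 1` identically vanishing bottom shells `Y 0 = … = Y k = 0`. GAME HYPOTHESIS (top form): in every play
of the depth-`k` rigid-damping virtual-floor game (`k + 1` real shells with exact dynamics and rates `Fr·Lⁱ`, a feed
`v ∈ [0, 1]` below, a virtual floor `y ∈ [0, 1]`, `ẏ ≥ -d·b2^{k+1}·y + Fr·L^{k+1}(S_k² - p·y)`, above, one scalar damping
`d ≥ 0`, data `≤ δ₀`) WHOSE REAL SHELLS ARE ALL `≤ 1` ON `[0, T]`, the top shell is `< 1` on `[0, T]`. Then every shell
of the chain stays `≤ 1` on `[0, s]`. Proof: bootstrap on the first `K` shells; at the closure time `T` every shell is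
`≤ 1` on `[0, T]`, and the window `n - k, …, n` below a live shell `n ≥ k + 1` IS such a play with `n` on top.
MODEL-lattice ODE lemma. [this file] -/
theorem gameBarrier_le_one_of_tail_top {Y : ℕ → ℝ → ℝ} {κ F : ℕ → ℝ} {L p s δ₀ b2 : ℝ} {K k : ℕ}
    (hs : 0 < s) (hκ : ∀ n, 0 ≤ κ n) (hκg : ∀ n, κ (n + 1) = b2 * κ n) (hF : ∀ n, 0 < F n)
    (hFL : ∀ n, F (n + 1) = L * F n) (hp : 0 < p) (hδ₀ : δ₀ < 1)
    (hGame : ∀ (Fr T : ℝ), 0 < Fr → 0 < T →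
      ∀ (S : ℕ → ℝ → ℝ) (d : ℝ) (v y : ℝ → ℝ),
      (∀ i, i ≤ k → ContinuousOn (S i) (Icc 0 T)) → ContinuousOn y (Icc 0 T) →
      (∀ i, i ≤ k → ∀ t ∈ Ico 0 T, HasDerivWithinAt (S i)
        (-(d * b2 ^ i) * S i t + Fr * L ^ i * ((if i = 0 then v t else S (i - 1) t) ^ 2 -
          p * S i t * (if i = k then y t else S (i + 1) t))) (Ici t) t) →
      (∀ t ∈ Ico 0 T, ∃ y' : ℝ, HasDerivWithinAt y y' (Ici t) t ∧
        -(d * b2 ^ (k + 1)) * y t + Fr * L ^ (k + 1) * (S k t ^ 2 - p * y t) ≤ y') →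
      0 ≤ d →
      (∀ t ∈ Icc 0 T, 0 ≤ v t ∧ v t ≤ 1) → (∀ t ∈ Icc 0 T, 0 ≤ y t ∧ y t ≤ 1) →
      (∀ i, i ≤ k → ∀ t ∈ Icc 0 T, 0 ≤ S i t) → (∀ i, i ≤ k → S i 0 ≤ δ₀) →
      (∀ i, i ≤ k → ∀ t ∈ Icc 0 T, S i t ≤ 1) →
      ∀ t ∈ Icc 0 T, S k t < 1)
    (hYz : ∀ n, n ≤ k → ∀ t, Y n t = 0)
    (hcont : ∀ n, ContinuousOn (Y n) (Icc 0 s))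
    (hderiv : ∀ n, 1 ≤ n → ∀ t ∈ Ico 0 s, HasDerivWithinAt (Y n)
      (-κ n * Y n t + F n * (Y (n - 1) t ^ 2 - p * Y n t * Y (n + 1) t)) (Ici t) t)
    (hpos : ∀ n, ∀ t ∈ Icc 0 s, 0 ≤ Y n t)
    (hinit : ∀ n, Y n 0 ≤ δ₀)
    (htail : ∀ n, K ≤ n → ∀ t ∈ Icc 0 s, Y n t ≤ δ₀) :
    ∀ n, ∀ t ∈ Icc 0 s, Y n t ≤ 1 := by
  -- the bootstrap predicate: the first `K` shells are `< 1`
  set P : ℝ → Prop := fun t => ∀ n, n ≤ K → Y n t < 1 with hP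
  have hall : ∀ t ∈ Icc (0 : ℝ) s, P t → ∀ n, Y n t < 1 := by
    intro t ht hPt n
    rcases le_or_gt n K with hn | hn
    · exact hPt n hn
    · exact (htail n hn.le t ht).trans_lt hδ₀
  have hP0 : P 0 := fun n _ => (hinit n).trans_lt hδ₀
  -- THE HEART: `P` is closed from the left — the game at the would-be crossing shell, placed ON TOP of its window
  have key : ∀ T ∈ Ioc (0 : ℝ) s, (∀ t ∈ Ico 0 T, P t) → P T := by
    intro T hT hPT n hnK
    have hTs : Icc (0 : ℝ) T ⊆ Icc 0 s := Icc_subset_Icc_right hT.2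
    have hTs' : Ico (0 : ℝ) T ⊆ Ico 0 s := Ico_subset_Ico_right hT.2
    -- every shell is `< 1` on `[0, T)` and `≤ 1` on `[0, T]`
    have hlt : ∀ j, ∀ t ∈ Ico (0 : ℝ) T, Y j t < 1 := fun j t ht => hall t (hTs (Ico_subset_Icc_self ht)) (hPT t ht) j
    have hle : ∀ j, ∀ t ∈ Icc (0 : ℝ) T, Y j t ≤ 1 := fun j => le_one_of_lt_one_Ico (hcont j) hT (hlt j)
    rcases le_or_gt n k with hnk | hnk
    · -- a vanishing bottom shell
      rw [hYz n hnk]; exact one_pos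
    -- the window `m, …, m + k = n` with `m = n - k ≥ 1`
    set m : ℕ := n - k with hm
    have hm1 : 1 ≤ m := by simp only [hm]; omega
    have hnm : n = m + k := by simp only [hm]; omega
    -- the play
    have hFm : 0 < F m := hF m
    have hrate : ∀ i, F (m + i) = F m * L ^ i := rate_shift hFL m
    have hdamp : ∀ i, κ (m + i) = κ m * b2 ^ i := rate_shift hκg m
    have hplay := hGame (F m) T hFm hT.1 (fun i => Y (m + i)) (κ m) (Y (m - 1)) (Y (m + k + 1))
      (fun i _ => (hcont (m + i)).mono hTs) ((hcont (m + k + 1)).mono hTs)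
      ?_ ?_ (hκ m)
      (fun t ht => ⟨hpos (m - 1) t (hTs ht), hle (m - 1) t ht⟩)
      (fun t ht => ⟨hpos (m + k + 1) t (hTs ht), hle (m + k + 1) t ht⟩)
      (fun i _ t ht => hpos (m + i) t (hTs ht)) (fun i _ => hinit (m + i))
      (fun i _ t ht => hle (m + i) t ht)
      T ⟨hT.1.le, le_rfl⟩
    · rw [hnm]; exact hplay
    · -- the real shells obey the game dynamics (rates `F m · Lⁱ`, feeds and drains re-indexed)
      intro i hi t ht
      have h := hderiv (m + i) (by omega) t (hTs' ht)
      rw [hrate i, hdamp i] at h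
      refine h.congr_deriv ?_
      have e1 : (if i = 0 then Y (m - 1) t else Y (m + (i - 1)) t) = Y (m + i - 1) t := by
        split_ifs with hi0
        · rw [hi0, Nat.add_zero]
        · congr 1; omega
      have e2 : (if i = k then Y (m + k + 1) t else Y (m + (i + 1)) t) = Y (m + i + 1) t := by
        split_ifs with hik
        · rw [hik]
        · rfl
      rw [e1, e2]
    · -- the shell above the window is a VIRTUAL FLOOR while the shell above it is `≤ 1`
      intro t ht
      refine ⟨-κ (m + k + 1) * Y (m + k + 1) t + F (m + k + 1) *
          (Y (m + k + 1 - 1) t ^ 2 - p * Y (m + k + 1) t * Y (m + k + 1 + 1) t),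
        hderiv (m + k + 1) (by omega) t (hTs' ht), ?_⟩
      have hr : F (m + k + 1) = F m * L ^ (k + 1) := by rw [← hrate (k + 1)]; rfl
      have hdr : κ (m + k + 1) = κ m * b2 ^ (k + 1) := by rw [← hdamp (k + 1)]; rfl
      have e1 : m + k + 1 - 1 = m + k := by omega
      rw [hr, hdr, e1]
      have hy0 : 0 ≤ Y (m + k + 1) t := hpos _ t (hTs (Ico_subset_Icc_self ht))
      have hz1 : Y (m + k + 1 + 1) t ≤ 1 := hle _ t (Ico_subset_Icc_self ht)
      have hFL0 : 0 ≤ F m * L ^ (k + 1) := by rw [← hr]; exact (hF _).le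
      have h1 : p * Y (m + k + 1) t * Y (m + k + 1 + 1) t ≤ p * Y (m + k + 1) t :=
        mul_le_of_le_one_right (mul_nonneg hp.le hy0) hz1
      nlinarith [mul_le_mul_of_nonneg_left h1 hFL0]
  -- the maximal time of `P` is `s`, and `P` holds on `[0, s]`
  have hPall : ∀ t ∈ Icc (0 : ℝ) s, P t := by
    set T := Literature.Analysis.ODE.maximalTimeP P 0 s with hT
    have hTmem : T ∈ Icc (0 : ℝ) s := Literature.Analysis.ODE.maximalTimeP_mem hs.le hP0
    have hPT : ∀ t ∈ Icc (0 : ℝ) T, P t := fun t ht =>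
      Literature.Analysis.ODE.maximalTimeP_spec hs.le hP0 key ht
    -- `P` is an open condition on finitely many continuous shells: it holds right after `T`
    have hev : ∀ᶠ t in 𝓝[Icc 0 s] T, P t := by
      have hfin : ∀ n ∈ Finset.range (K + 1), ∀ᶠ t in 𝓝[Icc 0 s] T, Y n t < 1 := by
        intro n _
        have hc : ContinuousWithinAt (Y n) (Icc 0 s) T := hcont n T hTmem
        exact hc.eventually_lt continuousWithinAt_const (hPT T ⟨hTmem.1, le_rfl⟩ n (by
          have := Finset.mem_range.1 ‹n ∈ Finset.range (K + 1)›; omega))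
      have := (Finset.eventually_all (Finset.range (K + 1))).2 hfin
      filter_upwards [this] with t ht n hn
      exact ht n (Finset.mem_range.2 (Nat.lt_succ_of_le hn))
    by_cases hTs : T = s
    · intro t ht; exact hPT t (hTs ▸ ht)
    · exact absurd hev (Literature.Analysis.ODE.not_eventually_of_maximalTimeP_lt hs.le hP0
        (lt_of_le_of_ne hTmem.2 hTs))
  intro n t ht
  exact (hall t ht (hPall t ht) n).le

/-- **Top-shell reduction, unpadded interface.** The same conclusion for a chain presented exactly as in
`gameBarrier_le_one_of_tail_geom` (one vanishing shell `Y 0 = 0` below the datum): pad the chain with `k` further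
identically vanishing shells below (`Y' n = Y (n - k)`, rigid rates and dampings continued geometrically downwards) and apply
`gameBarrier_le_one_of_tail_top`. This is the form the lattice wrapper consumes. MODEL-lattice ODE lemma. [this file] -/
theorem gameBarrier_le_one_of_tail_top' {Y : ℕ → ℝ → ℝ} {κ F : ℕ → ℝ} {L p s δ₀ b2 : ℝ} {K k : ℕ}
    (hs : 0 < s) (hκ : ∀ n, 0 ≤ κ n) (hκg : ∀ n, κ (n + 1) = b2 * κ n) (hb2 : 0 < b2) (hF : ∀ n, 0 < F n)
    (hFL : ∀ n, F (n + 1) = L * F n) (hp : 0 < p) (hδ₀ : δ₀ < 1)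
    (hGame : ∀ (Fr T : ℝ), 0 < Fr → 0 < T →
      ∀ (S : ℕ → ℝ → ℝ) (d : ℝ) (v y : ℝ → ℝ),
      (∀ i, i ≤ k → ContinuousOn (S i) (Icc 0 T)) → ContinuousOn y (Icc 0 T) →
      (∀ i, i ≤ k → ∀ t ∈ Ico 0 T, HasDerivWithinAt (S i)
        (-(d * b2 ^ i) * S i t + Fr * L ^ i * ((if i = 0 then v t else S (i - 1) t) ^ 2 -
          p * S i t * (if i = k then y t else S (i + 1) t))) (Ici t) t) →
      (∀ t ∈ Ico 0 T, ∃ y' : ℝ, HasDerivWithinAt y y' (Ici t) t ∧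
        -(d * b2 ^ (k + 1)) * y t + Fr * L ^ (k + 1) * (S k t ^ 2 - p * y t) ≤ y') →
      0 ≤ d →
      (∀ t ∈ Icc 0 T, 0 ≤ v t ∧ v t ≤ 1) → (∀ t ∈ Icc 0 T, 0 ≤ y t ∧ y t ≤ 1) →
      (∀ i, i ≤ k → ∀ t ∈ Icc 0 T, 0 ≤ S i t) → (∀ i, i ≤ k → S i 0 ≤ δ₀) →
      (∀ i, i ≤ k → ∀ t ∈ Icc 0 T, S i t ≤ 1) →
      ∀ t ∈ Icc 0 T, S k t < 1)
    (hY0 : ∀ t, Y 0 t = 0)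
    (hcont : ∀ n, ContinuousOn (Y n) (Icc 0 s))
    (hderiv : ∀ n, 1 ≤ n → ∀ t ∈ Ico 0 s, HasDerivWithinAt (Y n)
      (-κ n * Y n t + F n * (Y (n - 1) t ^ 2 - p * Y n t * Y (n + 1) t)) (Ici t) t)
    (hpos : ∀ n, ∀ t ∈ Icc 0 s, 0 ≤ Y n t)
    (hinit : ∀ n, Y n 0 ≤ δ₀)
    (htail : ∀ n, K ≤ n → ∀ t ∈ Icc 0 s, Y n t ≤ δ₀) :
    ∀ n, ∀ t ∈ Icc 0 s, Y n t ≤ 1 := by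
  -- `L > 0` from the rigid rates, `0 ≤ δ₀` from the vanishing shell
  have hL : 0 < L := by
    have h1 : 0 < L * F 0 := (hFL 0) ▸ hF 1
    exact pos_of_mul_pos_left h1 (hF 0).le
  have hδ0 : 0 ≤ δ₀ := (hY0 0).symm.le.trans (hinit 0)
  -- the padded chain
  set Y' : ℕ → ℝ → ℝ := fun n t => if n ≤ k then 0 else Y (n - k) t with hY'
  set κ' : ℕ → ℝ := fun n => κ 0 * b2 ^ n / b2 ^ k with hκ'
  set F' : ℕ → ℝ := fun n => F 0 * L ^ n / L ^ k with hF'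
  have hbk : 0 < b2 ^ k := pow_pos hb2 k
  have hLk : 0 < L ^ k := pow_pos hL k
  have hκsh : ∀ j, κ (0 + j) = κ 0 * b2 ^ j := rate_shift hκg 0
  have hFsh : ∀ j, F (0 + j) = F 0 * L ^ j := rate_shift hFL 0
  have hκ'eq : ∀ j, κ' (k + j) = κ j := by
    intro j; simp only [hκ']; rw [pow_add, ← zero_add j, hκsh j, zero_add]; field_simp
  have hF'eq : ∀ j, F' (k + j) = F j := by
    intro j; simp only [hF']; rw [pow_add, ← zero_add j, hFsh j, zero_add]; field_simp
  have hY'lo : ∀ n, n ≤ k → ∀ t, Y' n t = 0 := by intro n hn t; simp [hY', hn]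
  have hY'hi : ∀ j t, Y' (k + j) t = Y j t := by
    intro j t; rcases Nat.eq_zero_or_pos j with rfl | hj
    · simp [hY', hY0]
    · simp only [hY']; rw [if_neg (by omega)]; congr 1; omega
  have hmain := gameBarrier_le_one_of_tail_top (Y := Y') (κ := κ') (F := F') (K := K + k) (k := k) hs
    (fun n => by simp only [hκ']; exact div_nonneg (mul_nonneg (hκ 0) (pow_nonneg hb2.le n)) hbk.le)
    (fun n => by simp only [hκ']; rw [pow_succ]; field_simp)
    (fun n => by simp only [hF']; exact div_pos (mul_pos (hF 0) (pow_pos hL n)) hLk)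
    (fun n => by simp only [hF']; rw [pow_succ]; field_simp) hp hδ₀ hGame hY'lo ?_ ?_ ?_ ?_ ?_
  · intro n t ht
    have := hmain (k + n) t ht
    rwa [hY'hi] at this
  · -- continuity
    intro n
    by_cases hn : n ≤ k
    · have : Y' n = fun _ => 0 := funext (hY'lo n hn)
      rw [this]; exact continuousOn_const
    · obtain ⟨j, rfl⟩ : ∃ j, n = k + j := ⟨n - k, by omega⟩
      have : Y' (k + j) = Y j := funext (hY'hi j)
      rw [this]; exact hcont j
  · -- equations of motion
    intro n hn t ht
    by_cases hnk : n ≤ k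
    · -- a padded zero shell (its feed is a zero shell too)
      have h0 : Y' n = fun _ => 0 := funext (hY'lo n hnk)
      have h1 : Y' (n - 1) t = 0 := hY'lo (n - 1) (by omega) t
      rw [h0]
      have : -κ' n * (0 : ℝ) + F' n * (Y' (n - 1) t ^ 2 - p * 0 * Y' (n + 1) t) = 0 := by rw [h1]; ring
      rw [this]
      exact hasDerivWithinAt_const t (Ici t) 0
    · obtain ⟨j, rfl⟩ : ∃ j, n = k + j := ⟨n - k, by omega⟩
      have hj : 1 ≤ j := by omega
      have h := hderiv j hj t ht
      have e0 : Y' (k + j) = Y j := funext (hY'hi j)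
      have e1 : Y' (k + j - 1) t = Y (j - 1) t := by
        rw [show k + j - 1 = k + (j - 1) by omega]; exact hY'hi (j - 1) t
      have e2 : Y' (k + j + 1) t = Y (j + 1) t := by
        rw [show k + j + 1 = k + (j + 1) by omega]; exact hY'hi (j + 1) t
      rw [e0, e1, e2, hκ'eq, hF'eq]
      exact h
  · intro n t ht
    by_cases hn : n ≤ k
    · rw [hY'lo n hn]
    · obtain ⟨j, rfl⟩ : ∃ j, n = k + j := ⟨n - k, by omega⟩
      rw [hY'hi]; exact hpos j t ht
  · intro n
    by_cases hn : n ≤ k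
    · rw [hY'lo n hn]; exact hδ0
    · obtain ⟨j, rfl⟩ : ∃ j, n = k + j := ⟨n - k, by omega⟩
      rw [hY'hi]; exact hinit j
  · intro n hn t ht
    obtain ⟨j, rfl⟩ : ∃ j, n = k + j := ⟨n - k, by omega⟩
    rw [hY'hi]; exact htail j (by omega) t ht

end Summit.NavierStokesRegularity.NavierStokesRegularity.Theorems.VirtualFloor

end
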